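import Summits.Ventures.PercRepro.C026OneSidedGoodDegree

/-!
# The reduced (CC) flow: ROW C-041 `(G⅔)` from a flow on the TWO-SIDED Bad sources alone (p6, gen 23)

Setting of `C026OneSidedGoodDegree`: `(D,A)` sources, `Good_t`, `Bad`, `GG`, `SG`; a source is **one-sided**
when `D_a = {a}` or `D_b = {b}`, **clean** when both, **two-sided** otherwise.  mine-3's certificate (CC)
(MINE3-GLUING §42) asks for a flow from ALL Bad sources (2 units each) into the Good sources of their
cluster cubes with capacities `GG 4 / SG 1`.  The one-sided Bad sources are already paid by the two K-cut
chains (`card_bad_le_card_gg_oneSidedA/B`: `#Bad(𝒰_a) ≤ #GG(𝒰_a)`, `#Bad(𝒰_b) ≤ #GG(𝒰_b)`), which use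
`2` units of every GG source of `𝒰_a` and `2` of every GG source of `𝒰_b` — all `4` units of a clean GG
source, `2` of a one-sided non-clean one, none of a two-sided one.  So `(G⅔)` follows from a flow on the
TWO-SIDED Bad sources alone with the REDUCED capacities

  clean GG `0` · one-sided non-clean GG `2` · two-sided GG `4` · SG `1`

(`card_bad_le_of_twoSided_flow`): by double counting, `2·#Bad₂ ≤ 2·#GG₁′ + 4·#GG₂ + #SG`, and with
`2·#Bad₁ ≤ 2·(#GG(𝒰_a) + #GG(𝒰_b)) = 2·#GG₁ + 2·#GG_clean` this adds up to `2·#Bad ≤ 4·#GG + #SG`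
(`#GG₁ = #GG₁′ + #GG_clean`, `#GG = #GG₁ + #GG₂`).  The reduced flow is max-flow feasible on every graph
tested (own enumerator lean-drafts/p6/g23/twin/redflow.py: hub, 6-core, W9 236 / 236, the 3-tooth comb,
the n = 8 cores, the 3-hub skeleton, all labelled simple graphs on 5 vertices, 130 random multigraphs
n ≤ 8 with two-sided Bad sources — 0 infeasible), and the budget is tight on the 6-core and on W9.  Any
capacity function bounded by the reduced one also works (`hcap` is an inequality).

* `card_bad_le_of_twoSided_flow` — the bookkeeping theorem (`2·#Bad ≤ 4·#GG + #SG`);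
* `goodDegree_of_twoSided_flow` — ROW C-041 `(G⅔)`, `2·n(D,A) ≤ 3·(#Good_a + #Good_b)`;
* `pFun_threeCells_nonneg_of_twoSided_flow` — THEOREM L2 (live probe).
-/

namespace PercRepro

namespace MultiGraph

open Finset

variable {V E : Type*} {G : MultiGraph V E} [Fintype V] [DecidableEq V] [Fintype E] [DecidableEq E]

omit [Fintype V] [DecidableEq V] in
open Classical in
/-- **The reduced (CC) flow closes the count**: if every TWO-SIDED Bad source sends at least `2` units
to Good sources, a clean GG source receives none, a one-sided non-clean GG source at most `2`, a
two-sided GG source at most `4` and an SG source at most `1`, then `2·#Bad ≤ 4·#GG + #SG` — the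
one-sided Bad sources being paid by the K-cut chains of `C026OneSidedGoodDegree`. -/
theorem card_bad_le_of_twoSided_flow (a b c : V) (f : Config E → Config E → ℕ)
    (hsrc : ∀ S ∈ (univ.filter fun S : Config E => (((G.Conn S c a ∧ G.Conn S c b) ∧
          (¬ G.Conn Sᶜ c a ∧ ¬ G.Conn Sᶜ c b ∧ ¬ G.Conn Sᶜ a b)) ∧
          ¬ (G.WalkAvoiding S (G.cluster Sᶜ a) c b ∨ G.WalkAvoiding S (G.cluster Sᶜ b) c a)) ∧
          ¬ (G.cluster Sᶜ a = {a} ∨ G.cluster Sᶜ b = {b})),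
        2 ≤ ∑ T ∈ (univ.filter fun T : Config E => ((G.Conn T c a ∧ G.Conn T c b) ∧
          (¬ G.Conn Tᶜ c a ∧ ¬ G.Conn Tᶜ c b ∧ ¬ G.Conn Tᶜ a b)) ∧
          (G.WalkAvoiding T (G.cluster Tᶜ a) c b ∨ G.WalkAvoiding T (G.cluster Tᶜ b) c a)), f S T)
    (hcap : ∀ T ∈ (univ.filter fun T : Config E => ((G.Conn T c a ∧ G.Conn T c b) ∧
          (¬ G.Conn Tᶜ c a ∧ ¬ G.Conn Tᶜ c b ∧ ¬ G.Conn Tᶜ a b)) ∧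
          (G.WalkAvoiding T (G.cluster Tᶜ a) c b ∨ G.WalkAvoiding T (G.cluster Tᶜ b) c a)),
        ∑ S ∈ (univ.filter fun S : Config E => (((G.Conn S c a ∧ G.Conn S c b) ∧
          (¬ G.Conn Sᶜ c a ∧ ¬ G.Conn Sᶜ c b ∧ ¬ G.Conn Sᶜ a b)) ∧
          ¬ (G.WalkAvoiding S (G.cluster Sᶜ a) c b ∨ G.WalkAvoiding S (G.cluster Sᶜ b) c a)) ∧
          ¬ (G.cluster Sᶜ a = {a} ∨ G.cluster Sᶜ b = {b})), f S T ≤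
        if G.WalkAvoiding T (G.cluster Tᶜ a) c b ∧ G.WalkAvoiding T (G.cluster Tᶜ b) c a then
          (if G.cluster Tᶜ a = {a} ∧ G.cluster Tᶜ b = {b} then 0
            else if G.cluster Tᶜ a = {a} ∨ G.cluster Tᶜ b = {b} then 2 else 4)
        else 1) :
    2 * (univ.filter fun S : Config E => ((G.Conn S c a ∧ G.Conn S c b) ∧
          (¬ G.Conn Sᶜ c a ∧ ¬ G.Conn Sᶜ c b ∧ ¬ G.Conn Sᶜ a b)) ∧
          ¬ (G.WalkAvoiding S (G.cluster Sᶜ a) c b ∨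
            G.WalkAvoiding S (G.cluster Sᶜ b) c a)).card ≤
      4 * (univ.filter fun S : Config E => ((G.Conn S c a ∧ G.Conn S c b) ∧
          (¬ G.Conn Sᶜ c a ∧ ¬ G.Conn Sᶜ c b ∧ ¬ G.Conn Sᶜ a b)) ∧
          (G.WalkAvoiding S (G.cluster Sᶜ a) c b ∧ G.WalkAvoiding S (G.cluster Sᶜ b) c a)).card +
        (univ.filter fun S : Config E => ((G.Conn S c a ∧ G.Conn S c b) ∧
          (¬ G.Conn Sᶜ c a ∧ ¬ G.Conn Sᶜ c b ∧ ¬ G.Conn Sᶜ a b)) ∧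
          ((G.WalkAvoiding S (G.cluster Sᶜ a) c b ∧ ¬ G.WalkAvoiding S (G.cluster Sᶜ b) c a) ∨
            (G.WalkAvoiding S (G.cluster Sᶜ b) c a ∧
              ¬ G.WalkAvoiding S (G.cluster Sᶜ a) c b))).card := by
  -- the sets
  set Bad := univ.filter fun S : Config E => ((G.Conn S c a ∧ G.Conn S c b) ∧
    (¬ G.Conn Sᶜ c a ∧ ¬ G.Conn Sᶜ c b ∧ ¬ G.Conn Sᶜ a b)) ∧
    ¬ (G.WalkAvoiding S (G.cluster Sᶜ a) c b ∨ G.WalkAvoiding S (G.cluster Sᶜ b) c a) with hBad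
  set Good := univ.filter fun T : Config E => ((G.Conn T c a ∧ G.Conn T c b) ∧
    (¬ G.Conn Tᶜ c a ∧ ¬ G.Conn Tᶜ c b ∧ ¬ G.Conn Tᶜ a b)) ∧
    (G.WalkAvoiding T (G.cluster Tᶜ a) c b ∨ G.WalkAvoiding T (G.cluster Tᶜ b) c a) with hGood
  set Bad₂ := univ.filter fun S : Config E => (((G.Conn S c a ∧ G.Conn S c b) ∧
    (¬ G.Conn Sᶜ c a ∧ ¬ G.Conn Sᶜ c b ∧ ¬ G.Conn Sᶜ a b)) ∧
    ¬ (G.WalkAvoiding S (G.cluster Sᶜ a) c b ∨ G.WalkAvoiding S (G.cluster Sᶜ b) c a)) ∧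
    ¬ (G.cluster Sᶜ a = {a} ∨ G.cluster Sᶜ b = {b}) with hBad₂
  set GG := univ.filter fun S : Config E => ((G.Conn S c a ∧ G.Conn S c b) ∧
    (¬ G.Conn Sᶜ c a ∧ ¬ G.Conn Sᶜ c b ∧ ¬ G.Conn Sᶜ a b)) ∧
    (G.WalkAvoiding S (G.cluster Sᶜ a) c b ∧ G.WalkAvoiding S (G.cluster Sᶜ b) c a) with hGG
  set SG := univ.filter fun S : Config E => ((G.Conn S c a ∧ G.Conn S c b) ∧
    (¬ G.Conn Sᶜ c a ∧ ¬ G.Conn Sᶜ c b ∧ ¬ G.Conn Sᶜ a b)) ∧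
    ((G.WalkAvoiding S (G.cluster Sᶜ a) c b ∧ ¬ G.WalkAvoiding S (G.cluster Sᶜ b) c a) ∨
      (G.WalkAvoiding S (G.cluster Sᶜ b) c a ∧ ¬ G.WalkAvoiding S (G.cluster Sᶜ a) c b)) with hSG
  set BadA := univ.filter fun S : Config E => (((G.Conn S c a ∧ G.Conn S c b) ∧
    (¬ G.Conn Sᶜ c a ∧ ¬ G.Conn Sᶜ c b ∧ ¬ G.Conn Sᶜ a b)) ∧ G.cluster Sᶜ a = {a}) ∧
    ¬ (G.WalkAvoiding S (G.cluster Sᶜ a) c b ∨ G.WalkAvoiding S (G.cluster Sᶜ b) c a) with hBadA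
  set BadB := univ.filter fun S : Config E => (((G.Conn S c a ∧ G.Conn S c b) ∧
    (¬ G.Conn Sᶜ c a ∧ ¬ G.Conn Sᶜ c b ∧ ¬ G.Conn Sᶜ a b)) ∧ G.cluster Sᶜ b = {b}) ∧
    ¬ (G.WalkAvoiding S (G.cluster Sᶜ a) c b ∨ G.WalkAvoiding S (G.cluster Sᶜ b) c a) with hBadB
  set GGA := univ.filter fun S : Config E => (((G.Conn S c a ∧ G.Conn S c b) ∧
    (¬ G.Conn Sᶜ c a ∧ ¬ G.Conn Sᶜ c b ∧ ¬ G.Conn Sᶜ a b)) ∧ G.cluster Sᶜ a = {a}) ∧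
    (G.WalkAvoiding S (G.cluster Sᶜ a) c b ∧ G.WalkAvoiding S (G.cluster Sᶜ b) c a) with hGGA
  set GGB := univ.filter fun S : Config E => (((G.Conn S c a ∧ G.Conn S c b) ∧
    (¬ G.Conn Sᶜ c a ∧ ¬ G.Conn Sᶜ c b ∧ ¬ G.Conn Sᶜ a b)) ∧ G.cluster Sᶜ b = {b}) ∧
    (G.WalkAvoiding S (G.cluster Sᶜ a) c b ∧ G.WalkAvoiding S (G.cluster Sᶜ b) c a) with hGGB
  -- (1) the one-sided Bad sources: `#Bad₁ ≤ #GGA + #GGB` by the two K-cut chains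
  have hA : BadA.card ≤ GGA.card := card_bad_le_card_gg_oneSidedA a b c
  have hB : BadB.card ≤ GGB.card := card_bad_le_card_gg_oneSidedB a b c
  have hsplitBad : (Bad.filter fun S => G.cluster Sᶜ a = {a} ∨ G.cluster Sᶜ b = {b}).card +
      (Bad.filter fun S => ¬ (G.cluster Sᶜ a = {a} ∨ G.cluster Sᶜ b = {b})).card = Bad.card :=
    card_filter_add_card_filter_not _
  have hBad₂eq : (Bad.filter fun S => ¬ (G.cluster Sᶜ a = {a} ∨ G.cluster Sᶜ b = {b})) = Bad₂ := by
    rw [hBad, hBad₂, filter_filter]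
  have hsub : (Bad.filter fun S => G.cluster Sᶜ a = {a} ∨ G.cluster Sᶜ b = {b}) ⊆ BadA ∪ BadB := by
    intro S hS
    rw [mem_filter, hBad, mem_filter] at hS
    rw [mem_union, hBadA, hBadB, mem_filter, mem_filter]
    rcases hS.2 with h | h
    · exact Or.inl ⟨hS.1.1, ⟨hS.1.2.1, h⟩, hS.1.2.2⟩
    · exact Or.inr ⟨hS.1.1, ⟨hS.1.2.1, h⟩, hS.1.2.2⟩
  have hBad₁ := card_le_card hsub
  have hunion := card_union_le BadA BadB
  -- (2) the GG sources counted once per side: `#GGA + #GGB = #GG₁ + #GG_clean`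
  have hincl := card_union_add_card_inter GGA GGB
  have hGGunion : GGA ∪ GGB = GG.filter fun S => G.cluster Sᶜ a = {a} ∨ G.cluster Sᶜ b = {b} := by
    ext S
    rw [mem_union, hGGA, hGGB, hGG, mem_filter, mem_filter, mem_filter, mem_filter]
    constructor
    · rintro (⟨hu, ⟨hDA, h⟩, hgg⟩ | ⟨hu, ⟨hDA, h⟩, hgg⟩)
      · exact ⟨⟨hu, hDA, hgg⟩, Or.inl h⟩
      · exact ⟨⟨hu, hDA, hgg⟩, Or.inr h⟩
    · rintro ⟨⟨hu, hDA, hgg⟩, h | h⟩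
      · exact Or.inl ⟨hu, ⟨hDA, h⟩, hgg⟩
      · exact Or.inr ⟨hu, ⟨hDA, h⟩, hgg⟩
  have hGGinter : GGA ∩ GGB = GG.filter fun S => G.cluster Sᶜ a = {a} ∧ G.cluster Sᶜ b = {b} := by
    ext S
    rw [mem_inter, hGGA, hGGB, hGG, mem_filter, mem_filter, mem_filter, mem_filter]
    constructor
    · rintro ⟨⟨hu, ⟨hDA, ha⟩, hgg⟩, ⟨_, ⟨_, hb⟩, _⟩⟩
      exact ⟨⟨hu, hDA, hgg⟩, ha, hb⟩
    · rintro ⟨⟨hu, hDA, hgg⟩, ha, hb⟩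
      exact ⟨⟨hu, ⟨hDA, ha⟩, hgg⟩, ⟨hu, ⟨hDA, hb⟩, hgg⟩⟩
  rw [hGGunion, hGGinter] at hincl
  -- (3) the GG bookkeeping: `#GG = #GG₁ + #GG₂`, `#GG₁ = #GG₁′ + #GG_clean`
  have hsplitGG : (GG.filter fun S => G.cluster Sᶜ a = {a} ∨ G.cluster Sᶜ b = {b}).card +
      (GG.filter fun S => ¬ (G.cluster Sᶜ a = {a} ∨ G.cluster Sᶜ b = {b})).card = GG.card :=
    card_filter_add_card_filter_not _
  have hsplitGG₁ : ((GG.filter fun S => G.cluster Sᶜ a = {a} ∨ G.cluster Sᶜ b = {b}).filter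
        fun S => G.cluster Sᶜ a = {a} ∧ G.cluster Sᶜ b = {b}).card +
      ((GG.filter fun S => G.cluster Sᶜ a = {a} ∨ G.cluster Sᶜ b = {b}).filter
        fun S => ¬ (G.cluster Sᶜ a = {a} ∧ G.cluster Sᶜ b = {b})).card =
      (GG.filter fun S => G.cluster Sᶜ a = {a} ∨ G.cluster Sᶜ b = {b}).card :=
    card_filter_add_card_filter_not _
  have hclean : ((GG.filter fun S => G.cluster Sᶜ a = {a} ∨ G.cluster Sᶜ b = {b}).filter
      fun S => G.cluster Sᶜ a = {a} ∧ G.cluster Sᶜ b = {b}) =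
      GG.filter fun S => G.cluster Sᶜ a = {a} ∧ G.cluster Sᶜ b = {b} := by
    rw [filter_filter]
    apply filter_congr
    intro S _
    constructor
    · rintro ⟨_, h⟩
      exact h
    · intro h
      exact ⟨Or.inl h.1, h⟩
  rw [hclean] at hsplitGG₁
  -- (4) the flow, counted from the two-sided Bad sources and from the Good targets
  have h1 : 2 * Bad₂.card ≤ ∑ S ∈ Bad₂, ∑ T ∈ Good, f S T := by
    rw [mul_comm, ← smul_eq_mul, ← Finset.sum_const]
    exact Finset.sum_le_sum hsrc
  have h2 : ∑ S ∈ Bad₂, ∑ T ∈ Good, f S T = ∑ T ∈ Good, ∑ S ∈ Bad₂, f S T := Finset.sum_comm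
  have h3 : ∑ T ∈ Good, ∑ S ∈ Bad₂, f S T ≤ ∑ T ∈ Good,
      (if G.WalkAvoiding T (G.cluster Tᶜ a) c b ∧ G.WalkAvoiding T (G.cluster Tᶜ b) c a then
          (if G.cluster Tᶜ a = {a} ∧ G.cluster Tᶜ b = {b} then 0
            else if G.cluster Tᶜ a = {a} ∨ G.cluster Tᶜ b = {b} then 2 else 4)
        else 1) :=
    Finset.sum_le_sum hcap
  -- (5) the capacity total is `2·#GG₁′ + 4·#GG₂ + #SG`
  have hGoodGG : (Good.filter fun T => G.WalkAvoiding T (G.cluster Tᶜ a) c b ∧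
      G.WalkAvoiding T (G.cluster Tᶜ b) c a) = GG := by
    rw [hGood, hGG, filter_filter]
    apply filter_congr
    intro T _
    constructor
    · rintro ⟨⟨hDA, _⟩, hgg⟩
      exact ⟨hDA, hgg⟩
    · rintro ⟨hDA, hgg⟩
      exact ⟨⟨hDA, Or.inl hgg.1⟩, hgg⟩
  have hGoodSG : (Good.filter fun T => ¬ (G.WalkAvoiding T (G.cluster Tᶜ a) c b ∧
      G.WalkAvoiding T (G.cluster Tᶜ b) c a)) = SG := by
    rw [hGood, hSG, filter_filter]
    apply filter_congr
    intro T _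
    constructor
    · rintro ⟨⟨hDA, hor⟩, hnot⟩
      refine ⟨hDA, ?_⟩
      rcases hor with h | h
      · exact Or.inl ⟨h, fun h' => hnot ⟨h, h'⟩⟩
      · exact Or.inr ⟨h, fun h' => hnot ⟨h', h⟩⟩
    · rintro ⟨hDA, hor⟩
      rcases hor with ⟨h, h'⟩ | ⟨h, h'⟩
      · exact ⟨⟨hDA, Or.inl h⟩, fun hgg => h' hgg.2⟩
      · exact ⟨⟨hDA, Or.inr h⟩, fun hgg => h' hgg.1⟩
  have hA' : ((GG.filter fun S => ¬ (G.cluster Sᶜ a = {a} ∧ G.cluster Sᶜ b = {b})).filter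
        fun S => G.cluster Sᶜ a = {a} ∨ G.cluster Sᶜ b = {b}) =
      ((GG.filter fun S => G.cluster Sᶜ a = {a} ∨ G.cluster Sᶜ b = {b}).filter
        fun S => ¬ (G.cluster Sᶜ a = {a} ∧ G.cluster Sᶜ b = {b})) := by
    ext S
    simp only [mem_filter]
    tauto
  have hB' : ((GG.filter fun S => ¬ (G.cluster Sᶜ a = {a} ∧ G.cluster Sᶜ b = {b})).filter
        fun S => ¬ (G.cluster Sᶜ a = {a} ∨ G.cluster Sᶜ b = {b})) =
      GG.filter fun S => ¬ (G.cluster Sᶜ a = {a} ∨ G.cluster Sᶜ b = {b}) := by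
    ext S
    simp only [mem_filter]
    constructor
    · rintro ⟨⟨h1, _⟩, h2⟩
      exact ⟨h1, h2⟩
    · rintro ⟨h1, h2⟩
      exact ⟨⟨h1, fun h' => h2 (Or.inl h'.1)⟩, h2⟩
  have h4 : ∑ T ∈ Good,
      (if G.WalkAvoiding T (G.cluster Tᶜ a) c b ∧ G.WalkAvoiding T (G.cluster Tᶜ b) c a then
          (if G.cluster Tᶜ a = {a} ∧ G.cluster Tᶜ b = {b} then 0
            else if G.cluster Tᶜ a = {a} ∨ G.cluster Tᶜ b = {b} then 2 else 4)
        else 1) =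
      ((GG.filter fun S => G.cluster Sᶜ a = {a} ∨ G.cluster Sᶜ b = {b}).filter
          fun S => ¬ (G.cluster Sᶜ a = {a} ∧ G.cluster Sᶜ b = {b})).card * 2 +
        (GG.filter fun S => ¬ (G.cluster Sᶜ a = {a} ∨ G.cluster Sᶜ b = {b})).card * 4 +
        SG.card := by
    rw [Finset.sum_ite, hGoodGG, hGoodSG, Finset.sum_const, smul_eq_mul, mul_one,
      Finset.sum_ite, Finset.sum_const_zero, zero_add, Finset.sum_ite, Finset.sum_const,
      Finset.sum_const, smul_eq_mul, smul_eq_mul, hA', hB']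
  -- (6) add up
  rw [hBad₂eq] at hsplitBad
  omega

omit [Fintype V] [DecidableEq V] in
open Classical in
/-- **ROW C-041 `(G⅔)` from the reduced flow**: `2·n(D,A) ≤ 3·(#Good_a + #Good_b)`. -/
theorem goodDegree_of_twoSided_flow (a b c : V) (f : Config E → Config E → ℕ)
    (hsrc : ∀ S ∈ (univ.filter fun S : Config E => (((G.Conn S c a ∧ G.Conn S c b) ∧
          (¬ G.Conn Sᶜ c a ∧ ¬ G.Conn Sᶜ c b ∧ ¬ G.Conn Sᶜ a b)) ∧
          ¬ (G.WalkAvoiding S (G.cluster Sᶜ a) c b ∨ G.WalkAvoiding S (G.cluster Sᶜ b) c a)) ∧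
          ¬ (G.cluster Sᶜ a = {a} ∨ G.cluster Sᶜ b = {b})),
        2 ≤ ∑ T ∈ (univ.filter fun T : Config E => ((G.Conn T c a ∧ G.Conn T c b) ∧
          (¬ G.Conn Tᶜ c a ∧ ¬ G.Conn Tᶜ c b ∧ ¬ G.Conn Tᶜ a b)) ∧
          (G.WalkAvoiding T (G.cluster Tᶜ a) c b ∨ G.WalkAvoiding T (G.cluster Tᶜ b) c a)), f S T)
    (hcap : ∀ T ∈ (univ.filter fun T : Config E => ((G.Conn T c a ∧ G.Conn T c b) ∧
          (¬ G.Conn Tᶜ c a ∧ ¬ G.Conn Tᶜ c b ∧ ¬ G.Conn Tᶜ a b)) ∧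
          (G.WalkAvoiding T (G.cluster Tᶜ a) c b ∨ G.WalkAvoiding T (G.cluster Tᶜ b) c a)),
        ∑ S ∈ (univ.filter fun S : Config E => (((G.Conn S c a ∧ G.Conn S c b) ∧
          (¬ G.Conn Sᶜ c a ∧ ¬ G.Conn Sᶜ c b ∧ ¬ G.Conn Sᶜ a b)) ∧
          ¬ (G.WalkAvoiding S (G.cluster Sᶜ a) c b ∨ G.WalkAvoiding S (G.cluster Sᶜ b) c a)) ∧
          ¬ (G.cluster Sᶜ a = {a} ∨ G.cluster Sᶜ b = {b})), f S T ≤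
        if G.WalkAvoiding T (G.cluster Tᶜ a) c b ∧ G.WalkAvoiding T (G.cluster Tᶜ b) c a then
          (if G.cluster Tᶜ a = {a} ∧ G.cluster Tᶜ b = {b} then 0
            else if G.cluster Tᶜ a = {a} ∨ G.cluster Tᶜ b = {b} then 2 else 4)
        else 1) :
    2 * (univ.filter fun S : Config E => (G.Conn S c a ∧ G.Conn S c b) ∧
          (¬ G.Conn Sᶜ c a ∧ ¬ G.Conn Sᶜ c b ∧ ¬ G.Conn Sᶜ a b)).card ≤
        3 * ((univ.filter fun S : Config E => ((G.Conn S c a ∧ G.Conn S c b) ∧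
            (¬ G.Conn Sᶜ c a ∧ ¬ G.Conn Sᶜ c b ∧ ¬ G.Conn Sᶜ a b)) ∧
            G.WalkAvoiding S (G.cluster Sᶜ a) c b).card +
          (univ.filter fun S : Config E => ((G.Conn S c a ∧ G.Conn S c b) ∧
            (¬ G.Conn Sᶜ c a ∧ ¬ G.Conn Sᶜ c b ∧ ¬ G.Conn Sᶜ a b)) ∧
            G.WalkAvoiding S (G.cluster Sᶜ b) c a).card) :=
  (goodDegree_iff_bad_le_GG_SG a b c).2 (card_bad_le_of_twoSided_flow a b c f hsrc hcap)

open Classical in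
/-- **THEOREM L2 (live probe) from the reduced flow.** -/
theorem pFun_threeCells_nonneg_of_twoSided_flow (a b c : V) (f : Config E → Config E → ℕ)
    (hsrc : ∀ S ∈ (univ.filter fun S : Config E => (((G.Conn S c a ∧ G.Conn S c b) ∧
          (¬ G.Conn Sᶜ c a ∧ ¬ G.Conn Sᶜ c b ∧ ¬ G.Conn Sᶜ a b)) ∧
          ¬ (G.WalkAvoiding S (G.cluster Sᶜ a) c b ∨ G.WalkAvoiding S (G.cluster Sᶜ b) c a)) ∧
          ¬ (G.cluster Sᶜ a = {a} ∨ G.cluster Sᶜ b = {b})),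
        2 ≤ ∑ T ∈ (univ.filter fun T : Config E => ((G.Conn T c a ∧ G.Conn T c b) ∧
          (¬ G.Conn Tᶜ c a ∧ ¬ G.Conn Tᶜ c b ∧ ¬ G.Conn Tᶜ a b)) ∧
          (G.WalkAvoiding T (G.cluster Tᶜ a) c b ∨ G.WalkAvoiding T (G.cluster Tᶜ b) c a)), f S T)
    (hcap : ∀ T ∈ (univ.filter fun T : Config E => ((G.Conn T c a ∧ G.Conn T c b) ∧
          (¬ G.Conn Tᶜ c a ∧ ¬ G.Conn Tᶜ c b ∧ ¬ G.Conn Tᶜ a b)) ∧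
          (G.WalkAvoiding T (G.cluster Tᶜ a) c b ∨ G.WalkAvoiding T (G.cluster Tᶜ b) c a)),
        ∑ S ∈ (univ.filter fun S : Config E => (((G.Conn S c a ∧ G.Conn S c b) ∧
          (¬ G.Conn Sᶜ c a ∧ ¬ G.Conn Sᶜ c b ∧ ¬ G.Conn Sᶜ a b)) ∧
          ¬ (G.WalkAvoiding S (G.cluster Sᶜ a) c b ∨ G.WalkAvoiding S (G.cluster Sᶜ b) c a)) ∧
          ¬ (G.cluster Sᶜ a = {a} ∨ G.cluster Sᶜ b = {b})), f S T ≤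
        if G.WalkAvoiding T (G.cluster Tᶜ a) c b ∧ G.WalkAvoiding T (G.cluster Tᶜ b) c a then
          (if G.cluster Tᶜ a = {a} ∧ G.cluster Tᶜ b = {b} then 0
            else if G.cluster Tᶜ a = {a} ∨ G.cluster Tᶜ b = {b} then 2 else 4)
        else 1)
    {z κ x₁ K₁ x₂ K₂ : ℝ}
    (hz : 0 ≤ z ∧ z ≤ 1) (hκ : kMin z ≤ κ) (hx₁ : 0 ≤ x₁ ∧ x₁ ≤ 1) (hx₂ : 0 ≤ x₂ ∧ x₂ ≤ 1)
    (hK₁ : kMin x₁ ≤ K₁) (hK₂ : kMin x₂ ≤ K₂) :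
    0 ≤ G.pFun c (threeCells c a b z x₁ x₂) (threeCells c a b κ K₁ K₂) univ :=
  pFun_threeCells_nonneg_of_bad_le_GG_SG a b c (card_bad_le_of_twoSided_flow a b c f hsrc hcap)
    hz hκ hx₁ hx₂ hK₁ hK₂

end MultiGraph

end PercRepro
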